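import Literature.AlgebraicGeometry.Frobenioids.Cor54PrintedDiagram
import Literature.AlgebraicGeometry.Frobenioids.Cor411AsPrinted
import Literature.AlgebraicGeometry.Frobenioids.Cor411iAsPrinted
import HarnessLib

/-!
# Frobenioids I, Corollary 5.4 (Category-theoreticity of the Realification) for GENERAL Frobenioids, from
# PRINT'S INPUT hypotheses — the Cor. 4.10 / 4.11 package discharged by name

Mochizuki, *The geometry of Frobenioids I: the general theory*, Kyushu J. Math. **62** (2008) 293–400,
Cor. 5.4, kurims p. 103 l. 37 – p. 104 l. 9: "For `i = 1, 2`, let `Φ_i` be a perf-factorial divisorial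
monoid on a connected, totally epimorphic category `D_i` which is Div-slim [with respect to `Φ_i`];
`C_i → F_{Φ_i}` a Frobenioid of rationally standard type; `Ψ : C₁ ⥲ C₂` an equivalence of categories. If `C₁`,
`C₂` are of group-like type, then we also assume that both `Ψ` and some quasi-inverse to `Ψ` preserve
base-isomorphisms. Then there exists a 1-unique functor `Ψ^rlf : C₁^rlf → C₂^rlf` that fits into a
1-commutative diagram" (display: `C₁ → C₂` over `C₁^rlf → C₂^rlf`) "[where the vertical arrows are the natural
functors of Proposition 5.3; the horizontal arrows are equivalences of categories]. Moreover, each of the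
composite functors of this diagram is rigid."; proof p. 104 ll. 21–22: "In light of the definition of the
realification [cf. Proposition 5.3], Corollary 5.4 follows immediately from Corollaries 4.10; 4.11, (iii),
(iv)." [cite: MochizukiFrdI2008, Cor. 5.4 p.104]

PROOF-ONLY file (cell abc-iut, layer L1, seat abc-iut-L1-t10 gen 4, row «C54-AS-PRINTED KNIT», L1-lead
R128 (1) / R130 (1); closes note INFO-1 of the audit of `Cor54SubSquareCanonical.lean` by seat abc-iut-f-139:
"the file takes the Cor. 4.11/4.10 OUTPUT package as binders instead of print's INPUT hypotheses").  The
composition print asks for, BY NAME, now that every input is a theorem of the tree in print's generality: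

* Cor. 4.11 (i) AS TYPED at THE restriction `Ψ^istr` of `Ψ` — seat abc-iut-L1-t14's
  `PreFrobenioid.cor411i_ofFunctor` (`Cor411iAsPrinted.lean`): THE `Ψ^istr : C₁^istr ⥲ C₂^istr` over `Ψ` on the
  nose and `Ψ^un-tr` with its `1`-commutative square;
* Cor. 4.11 (ii)–(iv) — seat abc-iut-L1-d6's `FrdI.exists_cor411iv_data_ofFunctor` (`Cor411AsPrinted.lean`): THE
  `1`-unique `Ψ^Base` with `η : Base₂ ∘ Ψ ≅ Ψ^Base ∘ Base₁`, `Ψ^Φ = E` over `Ψ^Base` with the divisor formula on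
  all arrows, and "`Ψ` preserves Frobenius degrees";
* Cor. 4.10 through Thm. 3.4 (ii) AS PRINTED — seats abc-iut-L1-t11/t13's `FrdI.thm34ii_ofFunctor` (Thm. 3.4 (ii):
  "`Ψ` preserves pre-steps, co-angular pre-steps, and group-like objects", for `Ψ` and for `Ψ⁻¹`), which
  feeds seat abc-iut-w5-d221's `biratCompat_of` inside
  `FrdI.Cor54Sub.printedDiagram_of_preservesPreSteps` (this seat, `Cor54PrintedDiagram.lean`).

Result `FrdI.Cor54Sub.cor54_ofFunctor`: for EVERY pair of Frobenioids `C_i → F_{Φ_i}` with perf-factorial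
`Φ_i`, `C₁` of rational type at THE birationalization / support (the rationality conjunct of "rationally
standard", as in Cor. 4.11 (iii)/(iv)), and EVERY equivalence `Ψ` under the typed `Cor411Setting` (`D_i`
Div-slim, `C_i` of standard type, base-isomorphisms preserved in the group-like case — exactly print's
hypotheses), THERE EXISTS `Ψ^rlf : C₁^rlf → C₂^rlf` at THE realifications which is an EQUIVALENCE, makes the
square with print's vertical arrows `C_i → C_i^istr → C_i^rlf` `1`-COMMUTE, has BOTH composites `C₁ → C₂^rlf`
RIGID, and is INDUCED BY THE Cor. 4.11 data `(Ψ^Base, (Ψ^Φ)^rlf)` and `1`-UNIQUE among the functors so induced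
(the honest form of "1-unique", row C54/L07 of seat abc-iut-w5-d137's sub-DAG; the typed `PreFrobenioid.Cor54`'s
stronger-looking uniqueness over ALL square-filling functors is settled separately at `C₁ = C_{K/F}` by seats
abc-iut-w5-d227/w5-d048, `Cor54RigidityArithMorphisms` / `Cor54AsPrintedArithOfRigid`).  `cor54_ofFunctor_square`
records, in addition, the square at the level of the isotropic parts (`FrdI.Cor54Sub.Square` at THE `Ψ^istr` and
THE comparison equivalences).

No definition, no new notion; no statement of the paper is restated or strengthened; [FrdI] is a refereed
prerequisite paper — nothing here bears on [IUTchIII] Cor. 3.12.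
-/

namespace Literature.AlgebraicGeometry.Frobenioids

open CategoryTheory Opposite

universe w v v' u u'

namespace FrdI.Cor54Sub

open PreFrobenioidData (ofFunctor)
open PreFrobenioid

variable {D₁ : Type u} [Category.{v} D₁] {Φ₁ : D₁ᵒᵖ ⥤ CommMonCat.{w}} {C₁ : Type u'} [Category.{v'} C₁]
  {D₂ : Type u} [Category.{v} D₂] {Φ₂ : D₂ᵒᵖ ⥤ CommMonCat.{w}} {C₂ : Type u'} [Category.{v'} C₂]
  (F₁ : C₁ ⥤ ElemFrobenioid Φ₁) (F₂ : C₂ ⥤ ElemFrobenioid Φ₂)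
  (hΦ₁ : IsPerfFactorialOn Φ₁) (hΦ₂ : IsPerfFactorialOn Φ₂)

set_option backward.isDefEq.respectTransparency false in
/-- **[FrdI] Corollary 5.4 for GENERAL Frobenioids, from print's input hypotheses** ("follows immediately from
Corollaries 4.10; 4.11, (iii), (iv)"): for Frobenioids `C_i → F_{Φ_i}` with perf-factorial `Φ_i`, `C₁` of
rational type at THE birationalization / support, an equivalence `Ψ` and the typed `Cor411Setting` (`D_i`
Div-slim, `C_i` of standard type, base-isomorphisms preserved both ways in the group-like case), THERE EXISTS
`Ψ^rlf : C₁^rlf → C₂^rlf` at THE realifications which is an EQUIVALENCE, whose square with print's vertical arrows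
`C_i → C_i^istr → C_i^rlf` (isotropification of Prop. 1.9 (v), then THE `ι_i` of Prop. 5.3 at THE comparison
equivalences) `1`-COMMUTES, with BOTH composite functors `C₁ → C₂^rlf` RIGID, and which is INDUCED BY THE data of
Cor. 4.11 — THE `1`-unique `Ψ^Base` under `Ψ` (`η`), THE `Ψ^Φ = E` over it with `Div(Ψ φ) = η_A^* E(Div φ)` on
all arrows — through `(Ψ^Base, (Ψ^Φ)^rlf = rlfIso E)`, and `1`-UNIQUE among the functors `C₁^rlf → C₂^rlf` so
induced. [cite: MochizukiFrdI2008, Cor. 5.4 p.104] -/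
theorem cor54_ofFunctor (hF₁ : IsFrobenioid F₁) (hF₂ : IsFrobenioid F₂)
    (hrat₁ : ∀ A : C₁, PreFrobenioidData.IsRational
      (biratData hF₁ (hasBiratSquares_of_isFrobenioid hF₁))
      (S := ofFunctor Φ₁ F₁) (fun a 𝔭 => PrimarySupp a 𝔭) A)
    (Ψ : C₁ ≌ C₂) (hs : (ofFunctor Φ₁ F₁).Cor411Setting (ofFunctor Φ₂ F₂) Ψ) :
    ∃ Ψrlf : rlf F₁ hΦ₁ ⥤ rlf F₂ hΦ₂,
      Ψrlf.IsEquivalence ∧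
        OneCommutes Ψ.functor
          ((isotropification hF₂ ⋙ ObjectProperty.ιOfLE (isotropicObjects_le_ofFunctor F₂)) ⋙
            FrdI.Prop53Sub.iotaRlf F₂ hΦ₂ (untrComparison F₂ hF₂))
          ((isotropification hF₁ ⋙ ObjectProperty.ιOfLE (isotropicObjects_le_ofFunctor F₁)) ⋙
            FrdI.Prop53Sub.iotaRlf F₁ hΦ₁ (untrComparison F₁ hF₁))
          Ψrlf ∧
        (IsRigidFunctor
            (((isotropification hF₁ ⋙ ObjectProperty.ιOfLE (isotropicObjects_le_ofFunctor F₁)) ⋙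
                FrdI.Prop53Sub.iotaRlf F₁ hΦ₁ (untrComparison F₁ hF₁)) ⋙ Ψrlf) ∧
          IsRigidFunctor
            (Ψ.functor ⋙
              ((isotropification hF₂ ⋙ ObjectProperty.ιOfLE (isotropicObjects_le_ofFunctor F₂)) ⋙
                FrdI.Prop53Sub.iotaRlf F₂ hΦ₂ (untrComparison F₂ hF₂)))) ∧
        ∃ (ΨBase : D₁ ⥤ D₂)
          (E : PreFrobenioidData.DivisorMonoidIsoOverBase (ofFunctor Φ₁ F₁) (ofFunctor Φ₂ F₂) ΨBase)
          (η : Ψ.functor ⋙ (ofFunctor Φ₂ F₂).base ≅ (ofFunctor Φ₁ F₁).base ⋙ ΨBase),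
          PreFrobenioidData.OneUniqueSquare Ψ.functor (ofFunctor Φ₁ F₁).base (ofFunctor Φ₂ F₂).base ΨBase ∧
            (∀ ⦃A B : C₁⦄ (φ : A ⟶ B),
              Div F₂ (Ψ.functor.map φ) = pull Φ₂ (η.hom.app A) (E.iso (baseObj F₁ A) (Div F₁ φ))) ∧
            IsInducedBy F₁ hΦ₁ F₂ hΦ₂ ΨBase (rlfIso F₁ hΦ₁ F₂ hΦ₂ E) Ψrlf ∧
            ∀ Ψrlf' : rlf F₁ hΦ₁ ⥤ rlf F₂ hΦ₂,
              IsInducedBy F₁ hΦ₁ F₂ hΦ₂ ΨBase (rlfIso F₁ hΦ₁ F₂ hΦ₂ E) Ψrlf' → Nonempty (Ψrlf ≅ Ψrlf') := by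
  have hq₁ := hs.standard.1.quasiIsotropic
  have hq₂ := hs.standard.2.quasiIsotropic
  -- Cor. 4.11 (i): THE restriction `Ψ^istr` and `Ψ^un-tr` with its square
  obtain ⟨Ψi, hΨi, h411i⟩ := cor411i_ofFunctor hF₁ hF₂ hΦ₁ hΦ₂ Ψ hs
  obtain ⟨Ψuntr, hsqU, -, -⟩ := h411i hs
  obtain ⟨s⟩ := hsqU.2.1
  -- Cor. 4.11 (ii)–(iv): THE `Ψ^Base`, `η`, `Ψ^Φ = E` over `Ψ^Base`, degrees and divisors
  obtain ⟨ΨBase, E, η, hsqB, hdeg, hdiv, -, -⟩ := FrdI.exists_cor411iv_data_ofFunctor hF₁ hF₂ hΦ₁ hΦ₂ hrat₁ Ψ hs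
  haveI : ΨBase.IsEquivalence := hsqB.1
  -- Thm. 3.4 (ii) as printed, for `Ψ` and `Ψ⁻¹` (Cor. 4.10's input: (co-angular) pre-steps are preserved)
  obtain ⟨hpre, hco, -⟩ := FrdI.thm34ii_ofFunctor hF₁ hF₂ Ψ hq₁ hq₂ hs.standard.1.fsmff hs.standard.2.fsmff
  obtain ⟨hpre', hco', -⟩ :=
    FrdI.thm34ii_ofFunctor hF₂ hF₁ Ψ.symm hq₂ hq₁ hs.standard.2.fsmff hs.standard.1.fsmff
  obtain ⟨Ψrlf, hequiv, hind, hsq, hrig, huniq⟩ := printedDiagram_of_preservesPreSteps F₁ F₂ hΦ₁ hΦ₂ hF₁ hF₂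
    hq₁ hq₂ Ψ Ψi.functor (eqToIso hΨi) Ψuntr s ΨBase E η hdeg hdiv hpre hco hpre' hco'
  exact ⟨Ψrlf, hequiv, hsq, hrig hs.divSlim.1 hs.divSlim.2, ΨBase, E, η, hsqB, hdiv, hind, huniq⟩

set_option backward.isDefEq.respectTransparency false in
/-- **[FrdI] Cor. 5.4 for general Frobenioids — the same, recording also the square at the isotropic parts**:
`ι₁ ⋙ Ψ^rlf ≅ Ψ^istr ⋙ ι₂` for THE restriction `Ψ^istr : C₁^istr ⥲ C₂^istr` of `Ψ` (an equivalence lying over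
`Ψ` on the nose) and THE `ι_i : C_i^istr → C_i^rlf` of Prop. 5.3 (`FrdI.Cor54Sub.Square`, row C54/L06), next to
the square from `C_i` and the rigidity of its composites. [cite: MochizukiFrdI2008, Cor. 5.4 p.104] -/
theorem cor54_ofFunctor_square (hF₁ : IsFrobenioid F₁) (hF₂ : IsFrobenioid F₂)
    (hrat₁ : ∀ A : C₁, PreFrobenioidData.IsRational
      (biratData hF₁ (hasBiratSquares_of_isFrobenioid hF₁))
      (S := ofFunctor Φ₁ F₁) (fun a 𝔭 => PrimarySupp a 𝔭) A)
    (Ψ : C₁ ≌ C₂) (hs : (ofFunctor Φ₁ F₁).Cor411Setting (ofFunctor Φ₂ F₂) Ψ) :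
    ∃ (Ψistr : (ofFunctor Φ₁ F₁).Istr ≌ (ofFunctor Φ₂ F₂).Istr) (Ψrlf : rlf F₁ hΦ₁ ⥤ rlf F₂ hΦ₂),
      Ψistr.functor ⋙ (ofFunctor Φ₂ F₂).istrι = (ofFunctor Φ₁ F₁).istrι ⋙ Ψ.functor ∧
        Ψrlf.IsEquivalence ∧
          Square hΦ₁ hΦ₂ Ψistr.functor (untrComparison F₁ hF₁) (untrComparison F₂ hF₂) Ψrlf ∧
          OneCommutes Ψ.functor
            ((isotropification hF₂ ⋙ ObjectProperty.ιOfLE (isotropicObjects_le_ofFunctor F₂)) ⋙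
              FrdI.Prop53Sub.iotaRlf F₂ hΦ₂ (untrComparison F₂ hF₂))
            ((isotropification hF₁ ⋙ ObjectProperty.ιOfLE (isotropicObjects_le_ofFunctor F₁)) ⋙
              FrdI.Prop53Sub.iotaRlf F₁ hΦ₁ (untrComparison F₁ hF₁))
            Ψrlf ∧
          (IsRigidFunctor
              (((isotropification hF₁ ⋙ ObjectProperty.ιOfLE (isotropicObjects_le_ofFunctor F₁)) ⋙
                  FrdI.Prop53Sub.iotaRlf F₁ hΦ₁ (untrComparison F₁ hF₁)) ⋙ Ψrlf) ∧
            IsRigidFunctor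
              (Ψ.functor ⋙
                ((isotropification hF₂ ⋙ ObjectProperty.ιOfLE (isotropicObjects_le_ofFunctor F₂)) ⋙
                  FrdI.Prop53Sub.iotaRlf F₂ hΦ₂ (untrComparison F₂ hF₂)))) := by
  have hq₁ := hs.standard.1.quasiIsotropic
  have hq₂ := hs.standard.2.quasiIsotropic
  obtain ⟨Ψi, hΨi, h411i⟩ := cor411i_ofFunctor hF₁ hF₂ hΦ₁ hΦ₂ Ψ hs
  obtain ⟨Ψuntr, hsqU, -, -⟩ := h411i hs
  obtain ⟨s⟩ := hsqU.2.1
  obtain ⟨ΨBase, E, η, hsqB, hdeg, hdiv, -, -⟩ := FrdI.exists_cor411iv_data_ofFunctor hF₁ hF₂ hΦ₁ hΦ₂ hrat₁ Ψ hs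
  haveI : ΨBase.IsEquivalence := hsqB.1
  obtain ⟨hpre, hco, -⟩ := FrdI.thm34ii_ofFunctor hF₁ hF₂ Ψ hq₁ hq₂ hs.standard.1.fsmff hs.standard.2.fsmff
  obtain ⟨hpre', hco', -⟩ :=
    FrdI.thm34ii_ofFunctor hF₂ hF₁ Ψ.symm hq₂ hq₁ hs.standard.2.fsmff hs.standard.1.fsmff
  -- the joint closer at THE constructions (rows C54/L05–L07), with the `Φ^birat`-compatibility discharged
  obtain ⟨Ψrlf, hequiv, hind, hsqI, -⟩ := exists_rlfTransport_square_of_preservesPreSteps F₁ hΦ₁ F₂ hΦ₂ hF₁ hF₂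
    Ψ Ψi.functor (eqToIso hΨi) Ψuntr s ΨBase.asEquivalence E η hdeg hdiv hpre hco hpre' hco'
  -- the printed diagram for THIS `Ψ^rlf`: the two squares paste, the composites are rigid
  have htop := oneCommutes_isotropification_of_restricts hF₁ hF₂ hq₁ hq₂ Ψ Ψi.functor (eqToIso hΨi)
  have hbot : OneCommutes Ψi.functor (FrdI.Prop53Sub.iotaRlf F₂ hΦ₂ (untrComparison F₂ hF₂))
      (FrdI.Prop53Sub.iotaRlf F₁ hΦ₁ (untrComparison F₁ hF₁)) Ψrlf := ⟨hsqI.some.symm⟩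
  have hD₁' : (rlfData F₁ hΦ₁).IsDivSlim :=
    isDivSlim_ofFunctor_rlf Φ₁ F₁ (IsPerfFactorialOn.op hΦ₁) (rlfToElem F₁ hΦ₁) hs.divSlim.1
  have hD₂' : (rlfData F₂ hΦ₂).IsDivSlim :=
    isDivSlim_ofFunctor_rlf Φ₂ F₂ (IsPerfFactorialOn.op hΦ₂) (rlfToElem F₂ hΦ₂) hs.divSlim.2
  obtain ⟨hr₁, hr₂⟩ := rigid_of hΦ₁ hΦ₂ Ψi.functor (untrComparison F₁ hF₁) (untrComparison F₂ hF₂) Ψrlf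
    hD₁' hD₂' hsqI
  haveI : (ObjectProperty.ιOfLE (isotropicObjects_le_ofFunctor F₁)).IsEquivalence :=
    (ObjectProperty.isEquivalence_ιOfLE_iff _).2
      (le_trans (isotropicObjects_ofFunctor_le F₁) (ObjectProperty.le_isoClosure _))
  have key : ∀ {G : (ofFunctor Φ₁ F₁).Istr ⥤ rlf F₂ hΦ₂}, IsRigidFunctor G →
      IsRigidFunctor ((isotropification hF₁ ⋙ ObjectProperty.ιOfLE (isotropicObjects_le_ofFunctor F₁)) ⋙ G) :=
    fun {G} hG => IsRigidFunctor.leftAdjoint_comp (isotropificationAdjunction hF₁)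
      (IsRigidFunctor.comp_of_isEquivalence (ObjectProperty.ιOfLE (isotropicObjects_le_ofFunctor F₁)) hG)
  have htop' := htop.postcomp (FrdI.Prop53Sub.iotaRlf F₂ hΦ₂ (untrComparison F₂ hF₂))
  exact ⟨Ψi, Ψrlf, hΨi, hequiv, hsqI, htop.vcomp hbot, key hr₁, (key hr₂).of_iso htop'.some.symm⟩

end FrdI.Cor54Sub

end Literature.AlgebraicGeometry.Frobenioids
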